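import Mathlib
import HarnessLib
import Summits.Ventures.LatticeQCDFlow.Exactness.NCMCGeneralSpaceReplicaTStatisticUndercoverage

/-!
# STRICT under-coverage: for every `R ≥ 2` and every `q > 0`, `N(0,1)^{⊗R}{|z_{r₀}| ≤ q √((Σ_{r≠r₀} z_r²)/(R−1))} < N(0,1)([−q, q])`

HONEST FRAMING: exact (Metropolis-corrected) sampling algorithms for lattice gauge theory;
figures of merit are autocorrelation/cost numbers at stated couplings and volumes; no
continuum-physics claim.

Venture `LatticeQCDFlow` (cell pub-lqcd), topic `Exactness`; FANOUT row 13 (`eng-snf`, GEN-24).  NEW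
WORK of the cell against Mathlib (strict Jensen `StrictConcaveOn.ae_eq_const_or_lt_map_average`,
`Real.strictConcaveOn_sqrt`, `gaussianReal_absolutelyContinuous'` +
`AbsolutelyContinuous.isOpenPosMeasure` + `pi.isOpenPosMeasure`) and GEN-24
`NCMCGeneralSpaceReplicaTStatisticUndercoverage` (T: the concave symmetric Gaussian mass, the
conditioning identity, the second moments).  No definition; nothing cited as a fact.

WHY (row 13).  T proved `L_R(q) ≤ N(0,1)([−q, q])` (in GEN-24 S's Student-ratio form) for every
`R ≥ 2` and `q ≥ 0` and left strictness NOT CLAIMED.  This file closes it: for `q > 0` the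
inequality is STRICT — reading the engine's replica-jackknife / independent-runs bars with the
normal quantile under-covers for EVERY finite number of replicas, not only for `R = 2` (GEN-24 B).
Two strict steps: `E √V < √(E V) = 1` because `V = (Σ_{r≠r₀} Z_r²)/(R−1)` is not almost surely
constant (the product Gaussian charges the open box `{|z_r| < 1/2 ∀ r}`, on which `V ≤ 1/4`), and
`Φ̃` is STRICTLY increasing (the Gaussian charges every interval).

## Content
* `gaussianReal_real_Icc_neg_strictMono` (§1) — `0 ≤ a < b ⇒ N(0,1)([−a,a]) < N(0,1)([−b,b])`.
* `integral_sumSq_erase_div_eq_one`, **`integral_sqrt_sumSq_erase_div_lt_one`** (§2) — `E V = 1`,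
  `E √V < 1`.
* **`pi_gaussianReal_measure_abs_eval_le_mul_sqrt_lt`** (§3) — `q > 0`, `R ≥ 2`:
  `N(0,1)^{⊗R}{|z_{r₀}| ≤ q √((Σ_{r≠r₀} z_r²)/(R−1))} < N(0,1)([−q, q])`.

NOT CLAIMED: the size of the gap (see GEN-24 B for `R = 2` and `…ManyReplicas` for `R → ∞`);
anything numerical.
-/

namespace Summit.Ventures.LatticeQCDFlow.Exactness.GeneralNCMC

open MeasureTheory ProbabilityTheory Set Filter Topology Finset
open scoped ENNReal NNReal Topology

/-! ## §1 `Φ̃` is strictly increasing -/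

section StrictMono

/-- **`Φ̃(a) < Φ̃(b)` for `0 ≤ a < b`**: the standard Gaussian charges `(a, b)`. -/
theorem gaussianReal_real_Icc_neg_strictMono {a b : ℝ} (ha : 0 ≤ a) (hab : a < b) :
    (gaussianReal 0 1).real (Icc (-a) a) < (gaussianReal 0 1).real (Icc (-b) b) := by
  haveI : (gaussianReal (0 : ℝ) (1 : ℝ≥0)).IsOpenPosMeasure :=
    (gaussianReal_absolutelyContinuous' 0 one_ne_zero).isOpenPosMeasure
  have hpos : 0 < (gaussianReal 0 1).real (Ioo a b) :=
    ENNReal.toReal_pos ((isOpen_Ioo.measure_pos _ (nonempty_Ioo.2 hab)).ne') (measure_ne_top _ _)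
  have hdisj : Disjoint (Icc (-a) a) (Ioo a b) := by
    rw [Set.disjoint_iff]
    rintro x ⟨h1, h2⟩
    exact absurd h1.2 (not_le.2 h2.1)
  have hsub : Icc (-a) a ∪ Ioo a b ⊆ Icc (-b) b := by
    rintro x (h | h)
    · exact ⟨by linarith [h.1], by linarith [h.2]⟩
    · exact ⟨by linarith [h.1], h.2.le⟩
  calc (gaussianReal 0 1).real (Icc (-a) a)
      < (gaussianReal 0 1).real (Icc (-a) a) + (gaussianReal 0 1).real (Ioo a b) := by linarith
    _ = (gaussianReal 0 1).real (Icc (-a) a ∪ Ioo a b) :=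
        (measureReal_union hdisj measurableSet_Ioo).symm
    _ ≤ (gaussianReal 0 1).real (Icc (-b) b) := measureReal_mono hsub

end StrictMono

/-! ## §2 `E √V < 1` -/

section StrictJensen

variable {ι : Type*} [Fintype ι] [DecidableEq ι] [Nontrivial ι]

/-- `E (Σ_{r≠r₀} Z_r²)/(R−1) = 1` under `N(0,1)^{⊗R}`. -/
theorem integral_sumSq_erase_div_eq_one (r₀ : ι) :
    ∫ z, (∑ r ∈ univ.erase r₀, z r ^ 2) / ((Fintype.card ι : ℝ) - 1)
        ∂(Measure.pi fun _ : ι => gaussianReal 0 1) = 1 := by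
  set μ : Measure (ι → ℝ) := Measure.pi fun _ : ι => gaussianReal 0 1 with hμ
  have hR1 : (0 : ℝ) < (Fintype.card ι : ℝ) - 1 := by
    have h' : (1 : ℝ) < Fintype.card ι := by exact_mod_cast Fintype.one_lt_card (α := ι)
    linarith
  have h1 : ∀ r, ∫ z, z r ^ 2 ∂μ = 1 := by
    intro r
    have h := integral_mul_pi_gaussianReal (ι := ι) 1 r r
    rw [if_pos rfl, NNReal.coe_one] at h
    rw [← h]
    exact integral_congr_ae (Eventually.of_forall fun z => sq (z r))
  calc ∫ z, (∑ r ∈ univ.erase r₀, z r ^ 2) / ((Fintype.card ι : ℝ) - 1) ∂μ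
      = (∫ z, ∑ r ∈ univ.erase r₀, z r ^ 2 ∂μ) / ((Fintype.card ι : ℝ) - 1) := integral_div _ _
    _ = (∑ r ∈ univ.erase r₀, ∫ z, z r ^ 2 ∂μ) / ((Fintype.card ι : ℝ) - 1) := by
        rw [integral_finsetSum _ fun r _ => integrable_sq_eval_pi_gaussianReal r]
    _ = (∑ r ∈ univ.erase r₀, (1 : ℝ)) / ((Fintype.card ι : ℝ) - 1) := by
        rw [Finset.sum_congr rfl fun r _ => h1 r]
    _ = 1 := by
        rw [sum_const, Finset.card_erase_of_mem (mem_univ r₀), card_univ, nsmul_eq_mul, mul_one,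
          Nat.cast_sub Fintype.card_pos, Nat.cast_one, div_self hR1.ne']

/-- **`E √((Σ_{r≠r₀} Z_r²)/(R−1)) < 1`** under `N(0,1)^{⊗R}`: strict Jensen for the strictly concave
square root — the argument is not almost surely constant (the product Gaussian charges the open box
`{|z_r| < 1/2 ∀ r}`, where it is `≤ 1/4 < 1 = E V`). -/
theorem integral_sqrt_sumSq_erase_div_lt_one (r₀ : ι) :
    ∫ z, Real.sqrt ((∑ r ∈ univ.erase r₀, z r ^ 2) / ((Fintype.card ι : ℝ) - 1))
        ∂(Measure.pi fun _ : ι => gaussianReal 0 1) < 1 := by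
  set μ : Measure (ι → ℝ) := Measure.pi fun _ : ι => gaussianReal 0 1 with hμ
  have hR1 : (0 : ℝ) < (Fintype.card ι : ℝ) - 1 := by
    have h' : (1 : ℝ) < Fintype.card ι := by exact_mod_cast Fintype.one_lt_card (α := ι)
    linarith
  set V : (ι → ℝ) → ℝ := fun z => (∑ r ∈ univ.erase r₀, z r ^ 2) / ((Fintype.card ι : ℝ) - 1)
    with hV
  have hVint : Integrable V μ := by
    rw [hV]
    exact (integrable_finsetSum _ fun r _ => integrable_sq_eval_pi_gaussianReal r).div_const _
  have hVnn : ∀ z, 0 ≤ V z := fun z =>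
    div_nonneg (sum_nonneg fun r _ => sq_nonneg _) hR1.le
  have hVone : ∫ z, V z ∂μ = 1 := integral_sumSq_erase_div_eq_one r₀
  have hsqint : Integrable (Real.sqrt ∘ V) μ := by
    refine Integrable.mono' ((integrable_const (1 : ℝ)).add hVint) ?_ ?_
    · exact (Real.continuous_sqrt.measurable.comp hVint.aemeasurable.measurable_mk)
        |>.aestronglyMeasurable.congr
          (by filter_upwards [hVint.aemeasurable.ae_eq_mk] with z hz; simp [Function.comp, hz])
    · refine Eventually.of_forall fun z => ?_
      simp only [Function.comp_apply, Pi.add_apply, Real.norm_eq_abs]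
      rw [abs_of_nonneg (Real.sqrt_nonneg _)]
      have hv := hVnn z
      nlinarith [Real.sq_sqrt hv, Real.sqrt_nonneg (V z)]
  -- strict Jensen: either `V` is a.s. constant or the strict inequality holds
  have hJ := Real.strictConcaveOn_sqrt.ae_eq_const_or_lt_map_average (μ := μ) (f := V)
    Real.continuous_sqrt.continuousOn isClosed_Ici (Eventually.of_forall fun z => hVnn z) hVint
    hsqint
  simp only [average_eq_integral, hVone, Real.sqrt_one] at hJ
  rcases hJ with hconst | hlt
  · -- `V` is not a.s. equal to `1`: it is `≤ 1/4` on an open box of positive measure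
    exfalso
    haveI : (gaussianReal (0 : ℝ) (1 : ℝ≥0)).IsOpenPosMeasure :=
      (gaussianReal_absolutelyContinuous' 0 one_ne_zero).isOpenPosMeasure
    set B : Set (ι → ℝ) := Set.pi Set.univ fun _ => Ioo (-(1 / 2 : ℝ)) (1 / 2) with hB
    have hBopen : IsOpen B := isOpen_set_pi Set.finite_univ fun _ _ => isOpen_Ioo
    have hBne : B.Nonempty := ⟨fun _ => 0, fun r _ => by norm_num⟩
    have hBpos : 0 < μ B := hBopen.measure_pos μ hBne
    have hBsub : B ⊆ {z | V z ≠ 1} := by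
      intro z hz
      simp only [hB, Set.mem_pi, Set.mem_univ, true_implies, Set.mem_Ioo] at hz
      simp only [Set.mem_setOf_eq]
      have hsum : ∑ r ∈ univ.erase r₀, z r ^ 2 ≤ ∑ _r ∈ univ.erase r₀, (1 / 4 : ℝ) :=
        sum_le_sum fun r _ => by
          have := hz r
          nlinarith [this.1, this.2]
      rw [sum_const, Finset.card_erase_of_mem (mem_univ r₀), card_univ, nsmul_eq_mul,
        Nat.cast_sub Fintype.card_pos, Nat.cast_one] at hsum
      have hVle : V z ≤ 1 / 4 := by
        rw [hV]
        simp only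
        rw [div_le_iff₀ hR1]
        linarith
      linarith
    have hnull : μ {z | V z ≠ 1} = 0 := by
      have := hconst
      rw [Filter.EventuallyEq, ae_iff] at this
      simpa using this
    exact absurd (measure_mono_null hBsub hnull) hBpos.ne'
  · exact hlt

end StrictJensen

/-! ## §3 Strict under-coverage -/

section Strict

variable {ι : Type*} [Fintype ι] [DecidableEq ι] [Nontrivial ι]

/-- **STRICT UNDER-COVERAGE OF THE NORMAL QUANTILE, EVERY `R ≥ 2`**: for every coordinate `r₀` and
every `q > 0`, `N(0,1)^{⊗R}{z | |z_{r₀}| ≤ q √((Σ_{r ≠ r₀} z_r²)/(R−1))} < N(0,1)([−q, q])`. -/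
theorem pi_gaussianReal_measure_abs_eval_le_mul_sqrt_lt (r₀ : ι) {q : ℝ} (hq : 0 < q) :
    (Measure.pi fun _ : ι => gaussianReal 0 1) {z : ι → ℝ |
        |z r₀| ≤ q * Real.sqrt ((∑ r ∈ univ.erase r₀, z r ^ 2) / ((Fintype.card ι : ℝ) - 1))}
      < (gaussianReal 0 1) (Icc (-q) q) := by
  set μ : Measure (ι → ℝ) := Measure.pi fun _ : ι => gaussianReal 0 1 with hμ
  set W : (ι → ℝ) → ℝ := fun z =>
    Real.sqrt ((∑ r ∈ univ.erase r₀, z r ^ 2) / ((Fintype.card ι : ℝ) - 1)) with hW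
  have hWm : Measurable W := by
    have hc : ∀ r : ι, Measurable fun z : ι → ℝ => z r := fun r => measurable_pi_apply r
    rw [hW]; fun_prop
  have hWnn : ∀ z, 0 ≤ W z := fun z => Real.sqrt_nonneg _
  set Φ : ℝ → ℝ := fun x => 2 * ∫ t in (0 : ℝ)..x, gaussianPDFReal 0 1 t with hΦ
  have hΦeq : ∀ x, 0 ≤ x → (gaussianReal 0 1).real (Icc (-x) x) = Φ x := fun x hx =>
    gaussianReal_real_Icc_neg_eq_two_mul_integral hx
  have hR1 : (0 : ℝ) < (Fintype.card ι : ℝ) - 1 := by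
    have h' : (1 : ℝ) < Fintype.card ι := by exact_mod_cast Fintype.one_lt_card (α := ι)
    linarith
  have hVint : Integrable (fun z : ι → ℝ =>
      (∑ r ∈ univ.erase r₀, z r ^ 2) / ((Fintype.card ι : ℝ) - 1)) μ :=
    (integrable_finsetSum _ fun r _ => integrable_sq_eval_pi_gaussianReal r).div_const _
  have hWint : Integrable W μ := by
    refine Integrable.mono' ((integrable_const (1 : ℝ)).add hVint) hWm.aestronglyMeasurable ?_
    refine Eventually.of_forall fun z => ?_
    rw [Real.norm_eq_abs, abs_of_nonneg (hWnn z)]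
    simp only [Pi.add_apply]
    have hv : 0 ≤ (∑ r ∈ univ.erase r₀, z r ^ 2) / ((Fintype.card ι : ℝ) - 1) :=
      div_nonneg (sum_nonneg fun r _ => sq_nonneg _) hR1.le
    nlinarith [Real.sq_sqrt hv, Real.sqrt_nonneg ((∑ r ∈ univ.erase r₀, z r ^ 2)
      / ((Fintype.card ι : ℝ) - 1))]
  have hqWint : Integrable (fun z => q * W z) μ := hWint.const_mul q
  have hΦcont : Continuous Φ := continuous_iff_continuousAt.2 fun u =>
    ((hasDerivAt_integral_gaussianPDFReal u).const_mul 2).continuousAt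
  have hΦle : ∀ x, 0 ≤ x → Φ x ≤ 1 := fun x hx => by
    rw [← hΦeq x hx]; exact measureReal_le_one
  have hΦnn : ∀ x, 0 ≤ x → 0 ≤ Φ x := fun x hx => by
    rw [← hΦeq x hx]; exact measureReal_nonneg
  have hΦWint : Integrable (Φ ∘ fun z => q * W z) μ := by
    refine Integrable.mono' (integrable_const (1 : ℝ))
      ((hΦcont.measurable.comp (hWm.const_mul q)).aestronglyMeasurable) ?_
    refine Eventually.of_forall fun z => ?_
    have h0 : 0 ≤ q * W z := mul_nonneg hq.le (hWnn z)
    rw [Function.comp_apply, Real.norm_eq_abs, abs_of_nonneg (hΦnn _ h0)]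
    exact hΦle _ h0
  -- (1) conditioning
  have h1 : μ {z : ι → ℝ | |z r₀| ≤ q * W z} = ENNReal.ofReal (∫ z, Φ (q * W z) ∂μ) := by
    rw [hμ, hW, pi_gaussianReal_measure_abs_eval_le_mul_sqrt_eq_lintegral r₀ q,
      ← ofReal_integral_eq_lintegral_ofReal]
    · congr 1
      refine integral_congr_ae (Eventually.of_forall fun z => ?_)
      exact hΦeq _ (mul_nonneg hq.le (Real.sqrt_nonneg _))
    · refine Integrable.mono' (integrable_const (1 : ℝ)) ?_ (Eventually.of_forall fun z => ?_)
      · have : (fun z : ι → ℝ => (gaussianReal 0 1).real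
            (Icc (-(q * Real.sqrt ((∑ r ∈ univ.erase r₀, z r ^ 2) / ((Fintype.card ι : ℝ) - 1))))
              (q * Real.sqrt ((∑ r ∈ univ.erase r₀, z r ^ 2) / ((Fintype.card ι : ℝ) - 1)))))
              = Φ ∘ fun z => q * W z := by
          funext z
          exact hΦeq _ (mul_nonneg hq.le (Real.sqrt_nonneg _))
        rw [this]
        exact (hΦcont.measurable.comp (hWm.const_mul q)).aestronglyMeasurable
      · rw [Real.norm_eq_abs, abs_of_nonneg measureReal_nonneg]
        exact measureReal_le_one
    · exact Eventually.of_forall fun z => measureReal_nonneg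
  -- (2) Jensen
  have h2 : ∫ z, Φ (q * W z) ∂μ ≤ Φ (∫ z, q * W z ∂μ) :=
    concaveOn_two_mul_integral_gaussianPDFReal.le_map_integral hΦcont.continuousOn isClosed_Ici
      (Eventually.of_forall fun z => mem_Ici.2 (mul_nonneg hq.le (hWnn z))) hqWint hΦWint
  -- (3) STRICT: `∫ qW = q ∫ W < q` and `Φ` strictly increasing
  have h3 : ∫ z, q * W z ∂μ < q := by
    rw [integral_const_mul]
    have := integral_sqrt_sumSq_erase_div_lt_one (ι := ι) r₀
    calc q * ∫ z, W z ∂μ < q * 1 := mul_lt_mul_of_pos_left this hq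
      _ = q := mul_one q
  have h0int : 0 ≤ ∫ z, q * W z ∂μ := integral_nonneg fun z => mul_nonneg hq.le (hWnn z)
  have h4 : Φ (∫ z, q * W z ∂μ) < Φ q := by
    rw [← hΦeq _ h0int, ← hΦeq _ hq.le]
    exact gaussianReal_real_Icc_neg_strictMono h0int h3
  -- assemble
  rw [h1, ← ofReal_measureReal (measure_ne_top _ _), hΦeq q hq.le]
  exact (ENNReal.ofReal_lt_ofReal_iff_of_nonneg (integral_nonneg fun z =>
    hΦnn _ (mul_nonneg hq.le (hWnn z)))).2 (h2.trans_lt h4)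

end Strict

end Summit.Ventures.LatticeQCDFlow.Exactness.GeneralNCMC
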